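import Summits.ValiantsHypothesis.ValiantsHypothesis.Theorems.NewtonUnitEquationsTwoProductsRaySplitDefs
import Summits.ValiantsHypothesis.ValiantsHypothesis.Theorems.NewtonUnitEquationsTwoProductsRankOneSchemaLawPlanar
import Summits.ValiantsHypothesis.ValiantsHypothesis.Theorems.NewtonUnitEquationsTwoProductsConfinedTameLawBridge
import HarnessLib

/-!
# R11 (`freiman-ray-split`, val-idea-32 g0; Stage 1) — part A: the FREIMAN RAY-SPLITTING LIFT as an instance of the substitution engine
Letters `e = ν e • g (ι e)` on `K` rays are lifted to pure powers `Z_{ι e}^{ν e}`: `M k := single (ι (enum k)) (ν (enum k))`, and the chain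
difference lifts to `GT := phiT M (liftG cU cV) ∈ ℂ[Z_1..Z_K]` (= `P̃ − Q̃`) with push-forward `phi g GT = tailDiff u v`.  Under `RayCrossFree`
(+ independent rays) the planar projection `piE g` is injective on the lifted support (Freiman isomorphism on realised tuple sums), so every
visible point `l` lifts to a unique `x₀ ∈ GT.support` over `l` which is a STRICT minimiser of the positive functional `φ(z) = Σ_i z_i · (−wt ξ (g i))`.
Second hand val-lit-p3 g16 (desk #323 (iii)); first hand val-port-3 g2.  R11 is a proper positive sub-case rung; nothing here closes 5906; VP ≠ VNP
is NOT proved.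
-/

noncomputable section
set_option linter.dupNamespace false
set_option linter.unusedSectionVars false

namespace Summit.ValiantsHypothesis.ValiantsHypothesis.Theorems.NewtonUnitEquations.TwoProducts.PermutationType
namespace R11
open scoped BigOperators
open MvPolynomial
open Summit.ValiantsHypothesis.ValiantsHypothesis.Theorems.NewtonUnitEquations.TwoProducts.FormalLogLinearisation
open Summit.ValiantsHypothesis.ValiantsHypothesis.Theorems.NewtonUnitEquations.TwoProducts.PlanarCell
open Summit.ValiantsHypothesis.ValiantsHypothesis.Theorems.NewtonUnitEquations.TwoProducts.RaySplit

section Lift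
variable {m K : ℕ}
variable (u v : Fin m → MvPolynomial (Fin 2) ℂ) (g : Fin K → Expo) (ι : Expo → Fin K) (ν : Expo → ℕ)

/-- The FREIMAN LIFT of the letters: letter `k` ↦ `ν(e_k) · δ_{ι(e_k)} ∈ ℕ^K`. [val-idea-32] -/
def M (k : Fin (sE u v)) : Fin K →₀ ℕ := Finsupp.single (ι (enum u v k)) (ν (enum u v k))

/-- Under `OnRays`, the planar push-forward of the lift is the letter: `Σ_a M k a • g a = enum k`. [folklore] -/
theorem hG (hon : OnRays g ι ν (tailSupport u v)) (k : Fin (sE u v)) : ∑ a, (M u v ι ν k) a • g a = enum u v k := by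
  classical
  unfold M
  rw [Finset.sum_eq_single (ι (enum u v k))]
  · rw [Finsupp.single_eq_same]; exact (hon _ (enum_mem u v k)).symm
  · intro a _ ha; rw [Finsupp.single_eq_of_ne ha, zero_smul]
  · intro h; exact absurd (Finset.mem_univ _) h

/-- Letter-wise: push-forward ∘ lift = the letter map (dilation `1`). [folklore] -/
theorem comp_eq (hon : OnRays g ι ν (tailSupport u v)) :
    (fun k => piT g (M u v ι ν k)) = fun k => piT (R7b.dilE 1) (enum u v k) := by
  funext k
  rw [R7b.piT_dilE, one_smul]
  ext c
  rw [piT_apply, ← hG u v g ι ν hon k, Finsupp.coe_finsetSum, Finset.sum_apply]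
  exact Finset.sum_congr rfl fun a _ => by simp

/-- On exponents: push-forward ∘ lift = letter push-forward. [folklore] -/
theorem piE_g_piT (hon : OnRays g ι ν (tailSupport u v)) (L : Fin (sE u v) →₀ ℕ) :
    piE g (piT (M u v ι ν) L) = piE (enum u v) L := by
  rw [piE_eq_piT, piE_eq_piT, piT_piT, comp_eq u v g ι ν hon, ← piT_piT, R7b.piT_dilE, one_smul]

/-- Dilation by `1` is the identity push-forward. [folklore] -/
theorem phi_dilE_one (H : MvPolynomial (Fin 2) ℂ) : phi (R7b.dilE 1) H = H := by
  rw [phi_eq_phiT]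
  unfold phiT
  have hX : (fun t : Fin 2 => monomial (R7b.dilE 1 t) (1 : ℂ)) = X := by
    funext t; rfl
  rw [hX, MvPolynomial.aeval_X_left, AlgHom.id_apply]

/-- On polynomials: push-forward ∘ lift = letter push-forward. [folklore] -/
theorem phi_g_phiT (hon : OnRays g ι ν (tailSupport u v)) (H : MvPolynomial (Fin (sE u v)) ℂ) :
    phi g (phiT (M u v ι ν) H) = phi (enum u v) H := by
  rw [phi_eq_phiT, phi_eq_phiT, phiT_phiT, comp_eq u v g ι ν hon]
  rw [← phiT_phiT, ← phi_eq_phiT, ← phi_eq_phiT, phi_dilE_one]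

/-- **The lifted chain difference `P̃ − Q̃`.** [val-idea-32] -/
def GT : MvPolynomial (Fin K) ℂ := phiT (M u v ι ν) (liftG (cU u v) (cV u v))

/-- Its push-forward is the planar difference of products. [folklore] -/
theorem phi_GT (hon : OnRays g ι ν (tailSupport u v)) : phi g (GT u v ι ν) = tailDiff u v := by
  unfold GT
  rw [phi_g_phiT u v g ι ν hon, phi_liftG]

end Lift

section Inject
variable {m K : ℕ}
variable (u v : Fin m → MvPolynomial (Fin 2) ℂ) (g : Fin K → Expo) (ι : Expo → Fin K) (ν : Expo → ℕ)

/-- The RAY MASS of a letter vector on ray `i`: `Σ_k L k · [ι e_k = i] · ν e_k` = the `i`-th coordinate of its lift. [folklore] -/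
theorem piT_M_apply (L : Fin (sE u v) →₀ ℕ) (i : Fin K) :
    piT (M u v ι ν) L i = ∑ k, L k * (if ι (enum u v k) = i then ν (enum u v k) else 0) := by
  classical
  rw [piT_apply]
  refine Finset.sum_congr rfl fun k _ => ?_
  unfold M
  rw [Finsupp.single_apply]

/-- A weighted letter count of a realised tuple: `Σ_k L k · f (e_k) = Σ_j [a j ≠ 0] · f (a j)` when `msetT a = mapDomain enum L`. [folklore] -/
theorem sum_table_eq_sum_tuple (L : Fin (sE u v) →₀ ℕ) (a : Fin m → Expo) (ha : msetT a = Finsupp.mapDomain (enum u v) L)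
    (f : Expo → ℕ) : ∑ k, L k * f (enum u v k) = ∑ j, (if a j = 0 then 0 else f (a j)) := by
  classical
  -- both sides are `(msetT a).sum (fun e n => n * f e)`
  have h1 : ∑ k, L k * f (enum u v k) = (Finsupp.mapDomain (enum u v) L).sum fun e n => n * f e := by
    rw [Finsupp.sum_mapDomain_index_inj (enum_injective u v)]
    rw [Finsupp.sum_fintype _ _ (fun _ => by simp)]
  have h2 : (msetT a).sum (fun e n => n * f e) = ∑ j, (if a j = 0 then 0 else f (a j)) := by
    unfold msetT
    rw [← Finsupp.sum_finsetSum_index (by intros; simp) (by intros; simp [add_mul])]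
    refine Finset.sum_congr rfl fun j _ => ?_
    split_ifs with h
    · simp
    · rw [Finsupp.sum_single_index (by simp)]; simp
  rw [h1, ← ha, h2]

/-- Ray sums of a tuple in terms of ray masses: `raySum ι i a = (Σ_j [a j ≠ 0][ι (a j) = i] ν (a j)) • g i`. [folklore] -/
theorem raySum_eq (hon : OnRays g ι ν (tailSupport u v)) (a : Fin m → Expo) (ha : ∀ j, a j ≠ 0 → a j ∈ tailSupport u v) (i : Fin K) :
    raySum ι i a = (∑ j, (if a j = 0 then 0 else if ι (a j) = i then ν (a j) else 0)) • g i := by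
  classical
  unfold raySum
  rw [Finset.sum_smul]
  refine Finset.sum_congr rfl fun j _ => ?_
  by_cases h0 : a j = 0
  · simp [h0]
  · rw [if_neg h0]
    by_cases hi : ι (a j) = i
    · rw [if_pos hi, if_pos hi]
      have := hon _ (ha j h0)
      rw [hi] at this
      exact this
    · rw [if_neg hi, if_neg hi, zero_smul]

/-- Nonzero entries of a tuple of the letter family lie in the tail alphabet. [folklore] -/
theorem tuple_entry_mem {a : Fin m → Expo} (ha : a ∈ tuples (fun j => (u j).support ∪ (v j).support)) (j : Fin m) (h0 : a j ≠ 0) :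
    a j ∈ tailSupport u v := by
  classical
  unfold tuples at ha
  have hj := Fintype.mem_piFinset.mp ha j
  rw [Finset.mem_insert] at hj
  rcases hj with h | h
  · exact absurd h h0
  unfold tailSupport
  rw [Finset.mem_union, Finset.mem_biUnion, Finset.mem_biUnion]
  rcases Finset.mem_union.mp h with h | h
  · exact Or.inl ⟨j, Finset.mem_univ j, h⟩
  · exact Or.inr ⟨j, Finset.mem_univ j, h⟩

/-- A ray carrying a letter is a nonzero direction. [folklore] -/
theorem g_ne_zero_of_letter (hu : ∀ j, coeff 0 (u j) = 0) (hv : ∀ j, coeff 0 (v j) = 0)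
    (hon : OnRays g ι ν (tailSupport u v)) (k : Fin (sE u v)) : g (ι (enum u v k)) ≠ 0 := by
  intro h0
  have := hon _ (enum_mem u v k)
  rw [h0, smul_zero] at this
  exact enum_ne_zero u v hu hv k this

/-- **Freiman injectivity**: under `RayCrossFree` the planar projection is injective on the lifted support. [val-idea-32, Stage 1] -/
theorem injOn_of_rayCrossFree (hu : ∀ j, coeff 0 (u j) = 0) (hv : ∀ j, coeff 0 (v j) = 0)
    (hon : OnRays g ι ν (tailSupport u v)) (hcf : RayCrossFree ι (fun j => (u j).support ∪ (v j).support)) :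
    Set.InjOn (piE g) ↑(GT u v ι ν).support := by
  classical
  intro x hx x' hx' hπ
  obtain ⟨L, hL, rfl⟩ := exists_of_mem_support_phiT (M u v ι ν) _ x hx
  obtain ⟨L', hL', rfl⟩ := exists_of_mem_support_phiT (M u v ι ν) _ x' hx'
  rw [piE_g_piT u v g ι ν hon, piE_g_piT u v g ι ν hon] at hπ
  obtain ⟨a, ha, haS, haM⟩ := R10.tuple_of_mem_support_liftG u v hu hv L hL
  obtain ⟨b, hb, hbS, hbM⟩ := R10.tuple_of_mem_support_liftG u v hu hv L' hL'
  have hrs := hcf a ha b hb (by rw [haS, hbS, hπ])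
  ext i
  rw [piT_M_apply, piT_M_apply]
  have ea := sum_table_eq_sum_tuple u v L a haM (fun e => if ι e = i then ν e else 0)
  have eb := sum_table_eq_sum_tuple u v L' b hbM (fun e => if ι e = i then ν e else 0)
  rw [ea, eb]
  -- compare the ray sums on ray i
  have hra := raySum_eq u v g ι ν hon a (tuple_entry_mem u v ha) i
  have hrb := raySum_eq u v g ι ν hon b (tuple_entry_mem u v hb) i
  have h := hrs i
  rw [hra, hrb] at h
  by_cases hgi : g i = 0
  · -- no tail letter lies on ray i: all terms vanish on both sides
    have hz : ∀ c : Fin m → Expo, c ∈ tuples (fun j => (u j).support ∪ (v j).support) →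
        ∑ j, (if c j = 0 then 0 else if ι (c j) = i then ν (c j) else 0) = 0 := by
      intro c hc
      refine Finset.sum_eq_zero fun j _ => ?_
      by_cases h0 : c j = 0
      · simp [h0]
      · rw [if_neg h0, if_neg]
        intro hci
        have := hon _ (tuple_entry_mem u v hc j h0)
        rw [hci, hgi, smul_zero] at this
        exact h0 this
    rw [hz a ha, hz b hb]
  · -- cancel the nonzero direction
    have hne : ∃ c, (g i) c ≠ 0 := by
      by_contra hh; push Not at hh; exact hgi (Finsupp.ext fun c => by simpa using hh c)
    obtain ⟨c, hc⟩ := hne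
    have h' := congrArg (fun e : Expo => e c) h
    simp only [Finsupp.smul_apply, smul_eq_mul] at h'
    exact Nat.eq_of_mul_eq_mul_right (Nat.pos_of_ne_zero hc) h'

/-- **Visible points lift**: a strict `ξ`-top `l` of the tail support has a unique lifted exponent `x₀ ∈ GT.support` over it, and `x₀` is the
STRICT minimiser of the ray functional `θ i = −wt ξ (g i)` on the lifted support. [val-idea-32, Stage 1] -/
theorem lifted_of_visible (hu : ∀ j, coeff 0 (u j) = 0) (hv : ∀ j, coeff 0 (v j) = 0)
    (hon : OnRays g ι ν (tailSupport u v)) (hcf : RayCrossFree ι (fun j => (u j).support ∪ (v j).support))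
    (ξ : Fin 2 → ℝ) (l : Expo) (htop : IsStrictTop ξ ↑(tailDiff u v).support l) :
    ∃ x₀ : Fin K →₀ ℕ, x₀ ∈ (GT u v ι ν).support ∧ piE g x₀ = l ∧
      ∀ x ∈ (GT u v ι ν).support, x ≠ x₀ → lwt (fun i => -wt ξ (g i)) x₀ < lwt (fun i => -wt ξ (g i)) x := by
  classical
  have hinj := injOn_of_rayCrossFree u v g ι ν hu hv hon hcf
  have hsupp : phi g (GT u v ι ν) = tailDiff u v := phi_GT u v g ι ν hon
  obtain ⟨hl, hlt⟩ := htop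
  have hl' : l ∈ (phi g (GT u v ι ν)).support := by rw [hsupp]; exact hl
  obtain ⟨x₀, hx₀, hπ⟩ := exists_of_mem_support_phi g _ _ hl'
  refine ⟨x₀, hx₀, hπ, fun x hx hne => ?_⟩
  have hmem : piE g x ∈ (tailDiff u v).support := by
    rw [← hsupp, mem_support_iff, coeff_phi_of_injOn g _ hinj x hx]
    exact mem_support_iff.mp hx
  have hne' : piE g x ≠ l := by
    intro h; apply hne; apply hinj hx hx₀; rw [h, hπ]
  have h1 := hlt _ hmem hne'
  rw [lwt_eq_neg_wt, lwt_eq_neg_wt, hπ]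
  linarith

end Inject

end R11
end Summit.ValiantsHypothesis.ValiantsHypothesis.Theorems.NewtonUnitEquations.TwoProducts.PermutationType

end
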